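import Literature.NumberTheory.Transcendental.KZDilationLogSector
import Literature.NumberTheory.Transcendental.SemialgebraicLineDeriv
import Literature.NumberTheory.Transcendental.SemialgebraicRpow
import HarnessLib

/-!
# The logarithmic sector of the Kontsevich–Zagier dilation pencil, II: the lift

Setting of `KZDilationLogSector.lean`: `Q` Nash and positive on `(a, b) ⊇ [0,1]`, `h = Q'/Q`,
`v_h(ϖ) = ∫_{[0,1]¹} h(ϖz) dz` its dilation function. **Theorem** (`KZ.dilationLogSector_lift`):
if `Q(1) = Q(0)` (i.e. the cube period `∫₀¹ h` vanishes), then `v_h` factors on ALL of `[0,1]` as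
  `v_h(ϖ) = (ϖ − 1) · ∫_{[0,1]¹} K(ϖ, ϖ y) dy`
with ONE kernel `K` that is Nash on an open `V ⊇ [0,1] × [0,1]` (arguments in the `Matrix.vecCons`
format `K (vecCons ϖ (ϖ • y))`), i.e. `v_h ∈ (ϖ − 1)·D'` for the module `D'` of twisted-diagonal
Nash integrals. Construction (division trick): `R := (Q/Q(0))^{1/n}` is a Nash loop in `ℝ_{>0}`
with `R(0) = R(1) = 1`; `σ := dslope R 0` (`R(ϖ) = 1 + ϖσ(ϖ)`), `τ := dslope σ 1`
(`σ(ϖ) = (ϖ − 1)τ(ϖ)` as `σ(1) = 0`), both Nash (`IsSemialgebraicFunOn.dslope_ratCast`); the kernel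
  `K(p₀, p₁) := n · τ(p₀) / (1 + σ(p₀) p₁)`
satisfies `(ϖ − 1)∫₀¹ K(ϖ, ϖt) dt = n σ(ϖ) · log(1 + σ(ϖ)ϖ)/(σ(ϖ)ϖ) = n log R(ϖ)/ϖ = v_h(ϖ)`
(`∫₀¹ dt/(1 + ct) = log(1 + c)/c`), and it is regular on a neighbourhood of the whole square as soon
as `|σ| < 1` on `[0,1]`, which holds once `n > sup_{[0,1]} R·|h|` (`σ(ϖ) = R'(ξ)`, `R' = R h/n`).
This is the group-`𝔾_m` instance (no transcendence input: the vanishing period IS `Q(1) = Q(0)`) of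
the lifting mechanism "null-homotopic Nash loop in a commutative algebraic group ⇒ twisted kernel"
behind the dimension-one case of the dilation lifting problem of route
`KontsevichZagierPeriods/LiftingCriteria` (crux `DilationLiftAtOne`, stub `stub_glueAtOne`), where
the loop is supplied by Wüstholz's analytic subgroup theorem.

## References

* M. Kontsevich, D. Zagier, *Periods* (2001), §1.2. [`KontsevichZagier2001`]
* G. Wüstholz, *Algebraische Punkte auf analytischen Untergruppen algebraischer Gruppen*,
  Ann. of Math. 129 (1989) — context only (the general dimension-one argument), not used here.
  [`Wustholz1989`]

Everything is proved; no `def`, no named fact.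
-/

noncomputable section

open Set MeasureTheory Filter MvPolynomial
open scoped Topology
open Literature.ModelTheory.ExponentialFields

namespace Literature.NumberTheory.Transcendental

open SemialgebraicDerivative

namespace KZ.DilationLogSector

/-! ### The kernel `K(p) = n τ(p₀)/(1 + σ(p₀) p₁)` and its domain -/

section Kernel

variable {a b : ℝ} {σ τ : ℝ → ℝ}

/-- The domain `V = {p | p₀ ∈ (a,b), 1 + σ(p₀) p₁ > 0}` of the kernel is open. [folklore] -/
theorem isOpen_kernelDomain (hσc : ContinuousOn σ (Ioo a b)) :
    IsOpen {p : Fin 2 → ℝ | p 0 ∈ Ioo a b ∧ 0 < 1 + σ (p 0) * p 1} := by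
  have h1 : IsOpen {p : Fin 2 → ℝ | p 0 ∈ Ioo a b} := isOpen_Ioo.preimage (continuous_apply 0)
  have hA : ContinuousOn (fun p : Fin 2 → ℝ => σ (p 0)) {p : Fin 2 → ℝ | p 0 ∈ Ioo a b} :=
    hσc.comp (continuous_apply 0).continuousOn (fun p hp => hp)
  have hB : ContinuousOn (fun p : Fin 2 → ℝ => p 1) {p : Fin 2 → ℝ | p 0 ∈ Ioo a b} :=
    (continuous_apply 1).continuousOn
  have h2 : ContinuousOn (fun p : Fin 2 → ℝ => 1 + σ (p 0) * p 1) {p : Fin 2 → ℝ | p 0 ∈ Ioo a b} :=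
    continuousOn_const.add (hA.mul hB)
  exact h2.isOpen_inter_preimage h1 isOpen_Ioi

/-- The domain `V` is `ℚ`-semialgebraic (`∃ v, (p₀, v) ∈ Γ_σ ∧ 0 < 1 + v p₁`).
[cite: BochnakCosteRoy1998, Prop. 2.2.4] -/
theorem isSemialgebraic_kernelDomain
    (hσ : IsSemialgebraicFunOn ℚ {t : Fin 1 → ℝ | t 0 ∈ Ioo a b} (fun t => σ (t 0))) :
    IsSemialgebraic ℚ {p : Fin 2 → ℝ | p 0 ∈ Ioo a b ∧ 0 < 1 + σ (p 0) * p 1} := by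
  have hG := IsSemialgebraicFunOn.isSemialgebraic_graph_one hσ
  suffices key : IsSemialgebraic ℚ {p : Fin 2 → ℝ |
      ∃ v : ℝ, (p 0 ∈ Ioo a b ∧ v = σ (p 0)) ∧ 0 < 1 + v * p 1} by
    convert key using 1
    ext p
    simp only [mem_setOf_eq]
    constructor
    · rintro ⟨hp, hq⟩
      exact ⟨σ (p 0), ⟨hp, rfl⟩, hq⟩
    · rintro ⟨v, ⟨hp, rfl⟩, hq⟩
      exact ⟨hp, hq⟩
  refine sa_exists (sa_and (sa_graph₀ hG _ _) ?_)
  exact sa_atom 0 (1 + X 2 * X 1) fun z => by simp [Fin.init]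

/-- The kernel `K(p) = n τ(p₀) (1 + σ(p₀) p₁)⁻¹` is `ℚ`-semialgebraic on `V` when `σ`, `τ` are.
[cite: BochnakCosteRoy1998, Prop. 2.2.6] -/
theorem isSemialgebraicFunOn_kernel (n : ℕ)
    (hσ : IsSemialgebraicFunOn ℚ {t : Fin 1 → ℝ | t 0 ∈ Ioo a b} (fun t => σ (t 0)))
    (hτ : IsSemialgebraicFunOn ℚ {t : Fin 1 → ℝ | t 0 ∈ Ioo a b} (fun t => τ (t 0))) :
    IsSemialgebraicFunOn ℚ {p : Fin 2 → ℝ | p 0 ∈ Ioo a b ∧ 0 < 1 + σ (p 0) * p 1}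
      (fun p => (n:ℝ) * τ (p 0) * (1 + σ (p 0) * p 1)⁻¹) := by
  set V : Set (Fin 2 → ℝ) := {p : Fin 2 → ℝ | p 0 ∈ Ioo a b ∧ 0 < 1 + σ (p 0) * p 1} with hV_def
  have hV : IsSemialgebraic ℚ V := isSemialgebraic_kernelDomain hσ
  have hproj : IsSemialgebraicMapOn ℚ V (fun p : Fin 2 → ℝ => fun _ : Fin 1 => p 0) :=
    IsSemialgebraicMapOn.of_forall hV fun _ => by
      simpa using isSemialgebraicFunOn_aeval hV (X 0 : MvPolynomial (Fin 2) ℚ)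
  have hmaps : MapsTo (fun p : Fin 2 → ℝ => fun _ : Fin 1 => p 0) V
      {t : Fin 1 → ℝ | t 0 ∈ Ioo a b} := fun p hp => hp.1
  have hσV : IsSemialgebraicFunOn ℚ V (fun p => σ (p 0)) :=
    (IsSemialgebraicFunOn.comp_isSemialgebraicMapOn_holds hσ hproj hmaps).congr fun _ _ => rfl
  have hτV : IsSemialgebraicFunOn ℚ V (fun p => τ (p 0)) :=
    (IsSemialgebraicFunOn.comp_isSemialgebraicMapOn_holds hτ hproj hmaps).congr fun _ _ => rfl
  have h1 : IsSemialgebraicFunOn ℚ V (fun p : Fin 2 → ℝ => p 1) := by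
    simpa using isSemialgebraicFunOn_aeval hV (X 1 : MvPolynomial (Fin 2) ℚ)
  have hden : IsSemialgebraicFunOn ℚ V (fun p => 1 + σ (p 0) * p 1) :=
    ((isSemialgebraicFunOn_const_natCast hV 1).fun_add (hσV.fun_mul h1)).congr
      fun _ _ => by push_cast; rfl
  exact ((isSemialgebraicFunOn_const_natCast hV n).fun_mul hτV).fun_mul hden.fun_inv

/-- The kernel is real-analytic on `V` when `σ`, `τ` are real-analytic on `(a, b)`. [folklore] -/
theorem analyticOnNhd_kernel (n : ℕ) (hσa : ∀ x ∈ Ioo a b, AnalyticAt ℝ σ x)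
    (hτa : ∀ x ∈ Ioo a b, AnalyticAt ℝ τ x) :
    AnalyticOnNhd ℝ (fun p : Fin 2 → ℝ => (n:ℝ) * τ (p 0) * (1 + σ (p 0) * p 1)⁻¹)
      {p : Fin 2 → ℝ | p 0 ∈ Ioo a b ∧ 0 < 1 + σ (p 0) * p 1} := by
  intro p hp
  have h0 : AnalyticAt ℝ (fun p : Fin 2 → ℝ => p 0) p :=
    (ContinuousLinearMap.proj (R := ℝ) (φ := fun _ : Fin 2 => ℝ) 0).analyticAt p
  have h1 : AnalyticAt ℝ (fun p : Fin 2 → ℝ => p 1) p :=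
    (ContinuousLinearMap.proj (R := ℝ) (φ := fun _ : Fin 2 => ℝ) 1).analyticAt p
  have hσp : AnalyticAt ℝ (fun p : Fin 2 → ℝ => σ (p 0)) p :=
    AnalyticAt.comp (f := fun q : Fin 2 → ℝ => q 0) (hσa (p 0) hp.1) h0
  have hτp : AnalyticAt ℝ (fun p : Fin 2 → ℝ => τ (p 0)) p :=
    AnalyticAt.comp (f := fun q : Fin 2 → ℝ => q 0) (hτa (p 0) hp.1) h0
  exact (analyticAt_const.mul hτp).mul ((analyticAt_const.add (hσp.mul h1)).inv hp.2.ne')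

/-- **The kernel integral.** For `ϖ ∈ [0,1]` with `−1 < σ(ϖ)ϖ`:
`∫_{[0,1]¹} K(ϖ, ϖy) dy = n τ(ϖ) · J(σ(ϖ)ϖ)`, `J(c) = ∫₀¹ dt/(1 + ct)`. [folklore] -/
theorem setIntegral_kernel (n : ℕ) {ϖ : ℝ} (hc : -1 < σ ϖ * ϖ) :
    (∫ y in Set.pi Set.univ (fun _ : Fin 1 => Icc (0:ℝ) 1),
        (fun p : Fin 2 → ℝ => (n:ℝ) * τ (p 0) * (1 + σ (p 0) * p 1)⁻¹)
          (Matrix.vecCons ϖ (ϖ • y))) =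
      (n:ℝ) * τ ϖ * (if σ ϖ * ϖ = 0 then 1 else Real.log (1 + σ ϖ * ϖ) / (σ ϖ * ϖ)) := by
  have key : (∫ y in Set.pi Set.univ (fun _ : Fin 1 => Icc (0:ℝ) 1),
      (fun p : Fin 2 → ℝ => (n:ℝ) * τ (p 0) * (1 + σ (p 0) * p 1)⁻¹) (Matrix.vecCons ϖ (ϖ • y))) =
      ∫ t in Icc (0:ℝ) 1, (n:ℝ) * τ ϖ * (1 + (σ ϖ * ϖ) * t)⁻¹ := by
    have hfun : ∀ y : Fin 1 → ℝ,
        (fun p : Fin 2 → ℝ => (n:ℝ) * τ (p 0) * (1 + σ (p 0) * p 1)⁻¹) (Matrix.vecCons ϖ (ϖ • y)) =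
          (n:ℝ) * τ ϖ * (1 + (σ ϖ * ϖ) * y 0)⁻¹ := by
      intro y
      simp only [Matrix.cons_val_zero, Matrix.cons_val_one, Pi.smul_apply, smul_eq_mul]
      ring_nf
    simp_rw [hfun]
    exact setIntegral_cube_one (fun t => (n:ℝ) * τ ϖ * (1 + (σ ϖ * ϖ) * t)⁻¹)
  rw [key, integral_const_mul, setIntegral_inv_one_add_mul hc]

end Kernel

end KZ.DilationLogSector

namespace KZ

open DilationLogSector

/-! ### The lift -/

/-- **The logarithmic sector of the glue (`stub_glueAtOne` / crux `DilationLiftAtOne`, single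
generator, dimension one) holds unconditionally.** Let `Q` be Nash (`ℚ`-semialgebraic and
real-analytic) and positive on an open interval `(a, b) ⊇ [0,1]`, `h := Q'/Q` its logarithmic
derivative (`HasDerivAt Q (h x · Q x) x`), and suppose the period relation `∫₀¹ h = 0`, i.e.
`Q(1) = Q(0)`. Then the dilation function `v_h(ϖ) = ∫_{[0,1]¹} h(ϖ z) dz` factors on ALL of `[0,1]`
as `(ϖ − 1) · ∫_{[0,1]¹} K(ϖ, ϖ y) dy` with ONE kernel `K` Nash on an open `V ⊇ [0,1] × [0,1]`
(in the `Matrix.vecCons` format of the crux): `K(p) = n τ(p₀)/(1 + σ(p₀) p₁)` with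
`R = (Q/Q(0))^{1/n}`, `σ = dslope R 0`, `τ = dslope σ 1` and `n > sup_{[0,1]} R·|h|`
(division trick). [cite: KontsevichZagier2001, §1.2] -/
theorem dilationLogSector_lift {a b : ℝ} (ha : a < 0) (hb : 1 < b) {Q h : ℝ → ℝ}
    (hQs : IsSemialgebraicFunOn ℚ {t : Fin 1 → ℝ | t 0 ∈ Ioo a b} (fun t => Q (t 0)))
    (hQa : ∀ x ∈ Ioo a b, AnalyticAt ℝ Q x) (hpos : ∀ x ∈ Ioo a b, 0 < Q x)
    (hder : ∀ x ∈ Ioo a b, HasDerivAt Q (h x * Q x) x) (h01 : Q 1 = Q 0) :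
    ∃ (K : (Fin 2 → ℝ) → ℝ) (V : Set (Fin 2 → ℝ)), IsOpen V ∧
      (∀ ϖ ∈ Icc (0:ℝ) 1, ∀ x ∈ Set.pi Set.univ (fun _ : Fin 1 => Icc (0:ℝ) 1),
        Matrix.vecCons ϖ x ∈ V) ∧
      IsSemialgebraicFunOn ℚ V K ∧ AnalyticOnNhd ℝ K V ∧
      ∀ ϖ ∈ Icc (0:ℝ) 1,
        (∫ z in Set.pi Set.univ (fun _ : Fin 1 => Icc (0:ℝ) 1), h ((ϖ • z) 0)) =
          (ϖ - 1) * ∫ y in Set.pi Set.univ (fun _ : Fin 1 => Icc (0:ℝ) 1),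
            K (Matrix.vecCons ϖ (ϖ • y)) := by
  have h0I : (0:ℝ) ∈ Ioo a b := ⟨ha, zero_lt_one.trans hb⟩
  have h1I : (1:ℝ) ∈ Ioo a b := ⟨ha.trans zero_lt_one, hb⟩
  have hsub : Icc (0:ℝ) 1 ⊆ Ioo a b := fun x hx => ⟨ha.trans_le hx.1, hx.2.trans_lt hb⟩
  have hQ0 : 0 < Q 0 := hpos 0 h0I
  have hI : IsSemialgebraic ℚ {t : Fin 1 → ℝ | t 0 ∈ Ioo a b} :=
    IsSemialgebraicFunOn.isSemialgebraic_holds hQs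
  -- bounds on `[0,1]` and the choice of `n`
  have hcont_h : ContinuousOn h (Icc 0 1) := (continuousOn_logDeriv hQa hpos hder).mono hsub
  have hcont_Q : ContinuousOn Q (Icc 0 1) := fun x hx =>
    (hQa x (hsub hx)).continuousAt.continuousWithinAt
  obtain ⟨C, hC⟩ := isCompact_Icc.exists_bound_of_continuousOn hcont_h
  obtain ⟨B₀, hB₀⟩ := isCompact_Icc.exists_bound_of_continuousOn hcont_Q
  set B : ℝ := max 1 (B₀ * (Q 0)⁻¹) with hB_def
  have hB1 : 1 ≤ B := le_max_left _ _
  have hC0 : 0 ≤ C := le_trans (norm_nonneg _) (hC 0 ⟨le_rfl, zero_le_one⟩)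
  obtain ⟨n, hn⟩ : ∃ n : ℕ, B * C < n := exists_nat_gt (B * C)
  have hn0 : n ≠ 0 := by
    rintro rfl
    have : 0 ≤ B * C := mul_nonneg (zero_le_one.trans hB1) hC0
    push_cast at hn
    linarith
  have hnpos : (0:ℝ) < n := by exact_mod_cast Nat.pos_of_ne_zero hn0
  -- the `n`-th root `R = (Q/Q(0))^{1/n}`
  set R : ℝ → ℝ := fun x => (Q x * (Q 0)⁻¹) ^ ((n:ℝ)⁻¹) with hR_def
  have hR : ∀ x, R x = (Q x * (Q 0)⁻¹) ^ ((n:ℝ)⁻¹) := fun x => rfl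
  have hR0 : R 0 = 1 := by simp only [hR_def, mul_inv_cancel₀ hQ0.ne', Real.one_rpow]
  have hR1 : R 1 = 1 := by simp only [hR_def, h01, mul_inv_cancel₀ hQ0.ne', Real.one_rpow]
  have hq : ∀ x ∈ Ioo a b, 0 < Q x * (Q 0)⁻¹ := fun x hx => mul_pos (hpos x hx) (inv_pos.mpr hQ0)
  have hRpos : ∀ x ∈ Ioo a b, 0 < R x := fun x hx => Real.rpow_pos_of_pos (hq x hx) _
  have hRd : ∀ x ∈ Ioo a b, HasDerivAt R ((n:ℝ)⁻¹ * R x * h x) x := fun x hx =>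
    hasDerivAt_root hpos hder h0I hn0 hR hx
  have hRs : IsSemialgebraicFunOn ℚ {t : Fin 1 → ℝ | t 0 ∈ Ioo a b} (fun t => R (t 0)) := by
    have halg : IsAlgebraic ℚ (Q 0)⁻¹ := (hQs.isAlgebraic_apply_one h0I isAlgebraic_zero).inv
    have hf : IsSemialgebraicFunOn ℚ {t : Fin 1 → ℝ | t 0 ∈ Ioo a b}
        (fun t => Q (t 0) * (Q 0)⁻¹) :=
      hQs.fun_mul (isSemialgebraicFunOn_const_of_isAlgebraic hI halg)
    have hfpos : ∀ t ∈ {t : Fin 1 → ℝ | t 0 ∈ Ioo a b}, 0 < Q (t 0) * (Q 0)⁻¹ :=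
      fun t ht => hq _ ht
    refine (hf.rpow_ratCast hI hfpos ((n:ℚ)⁻¹)).congr fun t _ => ?_
    simp only [hR_def, Rat.cast_inv, Rat.cast_natCast]
  have hRa : ∀ x ∈ Ioo a b, AnalyticAt ℝ R x := fun x hx =>
    analyticAt_rpow_const_comp ((hQa x hx).mul analyticAt_const) (hq x hx) _
  -- `|R'| < 1` on `[0,1]`
  have hsmall : ∀ x ∈ Icc (0:ℝ) 1, |(n:ℝ)⁻¹ * R x * h x| < 1 := by
    intro x hx
    have hRle : R x ≤ B := by
      rcases le_or_gt (Q x * (Q 0)⁻¹) 1 with hle | hgt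
      · exact (Real.rpow_le_one (hq x (hsub hx)).le hle (inv_nonneg.mpr n.cast_nonneg)).trans hB1
      · have hQle : Q x ≤ B₀ := (le_abs_self _).trans (by simpa [Real.norm_eq_abs] using hB₀ x hx)
        calc R x ≤ (Q x * (Q 0)⁻¹) ^ (1:ℝ) :=
              Real.rpow_le_rpow_of_exponent_le hgt.le
                (inv_le_one_of_one_le₀ (by exact_mod_cast Nat.one_le_iff_ne_zero.mpr hn0))
          _ = Q x * (Q 0)⁻¹ := Real.rpow_one _
          _ ≤ B₀ * (Q 0)⁻¹ := mul_le_mul_of_nonneg_right hQle (inv_pos.mpr hQ0).le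
          _ ≤ B := le_max_right _ _
    have hRnn : 0 ≤ R x := (hRpos x (hsub hx)).le
    have hhx : |h x| ≤ C := by simpa [Real.norm_eq_abs] using hC x hx
    rw [abs_mul, abs_mul, abs_of_nonneg hRnn, abs_of_pos (inv_pos.mpr hnpos)]
    calc (n:ℝ)⁻¹ * R x * |h x| ≤ (n:ℝ)⁻¹ * B * C := by gcongr
      _ = (n:ℝ)⁻¹ * (B * C) := by ring
      _ < 1 := by rw [inv_mul_lt_iff₀ hnpos, mul_one]; exact hn
  -- `σ := dslope R 0`, `τ := dslope σ 1`
  set σ : ℝ → ℝ := dslope R 0 with hσ_def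
  have hσabs : ∀ ϖ ∈ Icc (0:ℝ) 1, |σ ϖ| < 1 := fun ϖ hϖ => abs_dslope_lt_one hRd hsub hsmall hϖ
  have hσs : IsSemialgebraicFunOn ℚ {t : Fin 1 → ℝ | t 0 ∈ Ioo a b} (fun t => σ (t 0)) := by
    have := IsSemialgebraicFunOn.dslope_ratCast (f' := fun x => (n:ℝ)⁻¹ * R x * h x) 0
      (by simpa using h0I) hRs hRd
    simpa using this
  have hσa : ∀ x ∈ Ioo a b, AnalyticAt ℝ σ x := fun x hx => analyticAt_dslope_of_analyticAt (hRa 0 h0I) (hRa x hx)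
  have hσd : ∀ x ∈ Ioo a b, HasDerivAt σ (deriv σ x) x := fun x hx =>
    (hσa x hx).differentiableAt.hasDerivAt
  have hσ0 : σ 0 = (n:ℝ)⁻¹ * R 0 * h 0 := by
    rw [hσ_def, dslope_same]
    exact (hRd 0 h0I).deriv
  have hσ1 : σ 1 = 0 := by
    rw [hσ_def, dslope_of_ne _ one_ne_zero, slope_def_field, hR1, hR0]
    simp
  have hσϖ : ∀ ϖ : ℝ, ϖ ≠ 0 → σ ϖ * ϖ = R ϖ - 1 := by
    intro ϖ _
    have := sub_smul_dslope R 0 ϖ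
    rw [sub_zero, smul_eq_mul, hR0] at this
    rw [mul_comm]
    exact this
  set τ : ℝ → ℝ := dslope σ 1 with hτ_def
  have hτs : IsSemialgebraicFunOn ℚ {t : Fin 1 → ℝ | t 0 ∈ Ioo a b} (fun t => τ (t 0)) := by
    have := IsSemialgebraicFunOn.dslope_ratCast (f' := deriv σ) 1 (by simpa using h1I) hσs hσd
    simpa using this
  have hτa : ∀ x ∈ Ioo a b, AnalyticAt ℝ τ x := fun x hx => analyticAt_dslope_of_analyticAt (hσa 1 h1I) (hσa x hx)
  have hτϖ : ∀ ϖ : ℝ, (ϖ - 1) * τ ϖ = σ ϖ := by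
    intro ϖ
    have := sub_smul_dslope σ 1 ϖ
    rw [smul_eq_mul, hσ1, sub_zero] at this
    exact this
  -- the kernel and its domain
  refine ⟨fun p => (n:ℝ) * τ (p 0) * (1 + σ (p 0) * p 1)⁻¹,
    {p : Fin 2 → ℝ | p 0 ∈ Ioo a b ∧ 0 < 1 + σ (p 0) * p 1},
    isOpen_kernelDomain (fun x hx => (hσa x hx).continuousAt.continuousWithinAt), ?_,
    isSemialgebraicFunOn_kernel n hσs hτs, analyticOnNhd_kernel n hσa hτa, ?_⟩
  · -- `[0,1] × [0,1]¹ ⊆ V`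
    intro ϖ hϖ x hx
    have hx0 : x 0 ∈ Icc (0:ℝ) 1 := hx 0 (mem_univ _)
    simp only [mem_setOf_eq, Matrix.cons_val_zero, Matrix.cons_val_one]
    refine ⟨hsub hϖ, ?_⟩
    have h1 : |σ ϖ * x 0| < 1 := by
      rw [abs_mul, abs_of_nonneg hx0.1]
      calc |σ ϖ| * x 0 ≤ |σ ϖ| * 1 := by gcongr; exact hx0.2
        _ < 1 := by rw [mul_one]; exact hσabs ϖ hϖ
    linarith [neg_abs_le (σ ϖ * x 0)]
  · -- the factorisation on `[0,1]`
    intro ϖ hϖ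
    have hc : -1 < σ ϖ * ϖ := by
      have h1 : |σ ϖ * ϖ| < 1 := by
        rw [abs_mul, abs_of_nonneg hϖ.1]
        calc |σ ϖ| * ϖ ≤ |σ ϖ| * 1 := by gcongr; exact hϖ.2
          _ < 1 := by rw [mul_one]; exact hσabs ϖ hϖ
      linarith [neg_abs_le (σ ϖ * ϖ)]
    rw [setIntegral_kernel n hc]
    rcases hϖ.1.eq_or_lt with h0 | h0
    · -- `ϖ = 0`: both sides equal `h 0`
      subst h0
      rw [dilation_integral_zero]
      have hτ0 : (0 - 1) * τ 0 = σ 0 := hτϖ 0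
      rw [hR0, mul_one] at hσ0
      simp only [mul_zero, if_true]
      calc h 0 = (n:ℝ) * σ 0 := by rw [hσ0]; field_simp
        _ = (0 - 1) * ((n:ℝ) * τ 0 * 1) := by rw [← hτ0]; ring
    · -- `0 < ϖ ≤ 1`
      rw [dilation_integral ha hb hQa hpos hder ⟨h0, hϖ.2⟩]
      have hlog : Real.log (Q ϖ) - Real.log (Q 0) = n * Real.log (R ϖ) := by
        rw [← Real.log_div (hpos ϖ (hsub hϖ)).ne' hQ0.ne', div_eq_mul_inv, hR ϖ,
          Real.log_rpow (hq ϖ (hsub hϖ))]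
        field_simp
      rw [hlog]
      have h1R : 1 + σ ϖ * ϖ = R ϖ := by rw [hσϖ ϖ h0.ne']; ring
      split_ifs with hz
      · have hσz : σ ϖ = 0 := (mul_eq_zero.mp hz).resolve_right h0.ne'
        have hRone : R ϖ = 1 := by rw [← h1R, hz, add_zero]
        rw [hRone, Real.log_one, mul_zero, zero_div]
        calc (0:ℝ) = (n:ℝ) * ((ϖ - 1) * τ ϖ) := by rw [hτϖ, hσz, mul_zero]
          _ = (ϖ - 1) * ((n:ℝ) * τ ϖ * 1) := by ring
      · have hσne : σ ϖ ≠ 0 := fun h' => hz (by rw [h', zero_mul])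
        have hϖne : ϖ ≠ 0 := h0.ne'
        rw [h1R]
        calc (n:ℝ) * Real.log (R ϖ) / ϖ
            = (n:ℝ) * ((ϖ - 1) * τ ϖ) * (Real.log (R ϖ) / (σ ϖ * ϖ)) := by
              rw [hτϖ]
              field_simp
          _ = (ϖ - 1) * ((n:ℝ) * τ ϖ * (Real.log (R ϖ) / (σ ϖ * ϖ))) := by ring

end KZ

end Literature.NumberTheory.Transcendental
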